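import Literature.Analysis.ValidatedNumerics.TaylorModelExtremaCert
import Literature.Analysis.ValidatedNumerics.ListPolynomial
import Mathlib.Algebra.Polynomial.Roots
import Mathlib.Topology.Order.IntermediateValue
import HarnessLib

/-!
# Kernel-checked supremum norms of approximation errors and de la Vallée-Poussin brackets of the minimax
# error (weighted; polynomial and rational approximants) for straight-line programs

Trunk T-ANA (Analysis/ValidatedNumerics); namespace `Literature.Analysis.ValidatedNumerics.PolyMP`.
Sequel of `TaylorModelExtremaCert.lean` (the extrema certificate `T.extremaCheck` of a program `p : GProg M` of a
statement family `M : OpModel`, `F : OpSem M`, `T : OpTangent M F` on `[a, b]`: `mlo ≤ P(ps; t) ≤ xhi`, attainment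
below `mhi` / above `xlo`) and of `TaylorModelZeroCert.lean` (the POINT model `M.pointI`: `P(ps; x)·S ∈ [Y̲, Ȳ]`,
`mem_pointI`).  THE PROBLEM (Chevillard–Harrison–Joldeş–Lauter): given `f`, an approximant `p` (a polynomial, or a
rational function `P/Q`) and an interval `[a, b]`, enclose the SUPREMUM NORM of the (absolute `p − f`, or relative
`p/f − 1`, here: weighted `w·(f − p)`) approximation error, `ℓ ≤ ‖ε‖_∞ ≤ u`, with a validated `u` — the step of
every correctly-rounded elementary-function implementation that the cited paper found "not available in formal
proof checkers" by the direct route (rigorous zero isolation of `ε′` + automatic differentiation, their Sect. 2.3 /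
Ref. [18]) and reduced instead to polynomial non-negativity checked in HOL Light (their Algorithm 3.1).  This lane's
kernel HAS the direct route: `ε` is a program, `ε′` its tangent program, and `extremaCheck` decides the complete
variation table of `ε` on `[a, b]`; this module reads the supremum norm off it (Part C), and adds what turns a
supremum norm into a statement about BEST approximation: DE LA VALLÉE-POUSSIN'S THEOREM (Part A) with a kernel
certificate of its hypothesis (Part B) — if the weighted error of `p` alternates in sign on `n + 2` ordered points
where its modulus is at least `δ` (`m + k + 2` points for `P/Q ∈ R_{m,k}`), then NO polynomial of degree `≤ n`
(no `P̃/Q̃ ∈ R_{m,k}` with `Q̃ > 0`) has weighted error below `δ` on `[a, b]`; with the supremum norm `Δ` of the same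
error, `δ ≤ E_n(f) ≤ Δ` brackets the minimax error, as tightly as `p` is close to equioscillation, WITHOUT computing
or characterising the best approximation:

* Part A — DE LA VALLÉE-POUSSIN over `ℝ` (no models; Mathlib's `Polynomial ℝ`): alternation data `AltSigns g xs`
  (`xs` a `List.IsChain` of increasing points with `g(xᵢ)·g(xᵢ₊₁) < 0`); `not_altSigns_of_natDegree_lt` — no
  polynomial of degree `≤ N` alternates on `N + 2` ordered points (the intermediate value theorem puts a zero in each
  of the `N + 1` gaps, and a polynomial with more zeros than its degree vanishes, `Polynomial.eq_zero_of_natDegree_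
  lt_card_of_eval_eq_zero'`); the WEIGHTED POLYNOMIAL theorem `exists_le_abs_of_altSigns` (`w > 0` at the points,
  `deg p ≤ n`, `n + 2` points: every `q` with `deg q ≤ n` has `|w (f − q)| ≥ δ` at one of the points) and the
  RATIONAL one `exists_le_abs_of_altSigns_rat` (`P/Q`, `deg P ≤ m`, `deg Q ≤ k`, `Q > 0` and `w > 0` at the
  `m + k + 2` points: every `P̃/Q̃` of the same class with `Q̃ > 0` at the points has `|w (f − P̃/Q̃)| ≥ δ` at one of
  them — Property Z of `R_{m,k}` via `P̃/Q̃ − P/Q = (P̃Q − PQ̃)/(QQ̃)`, `deg (P̃Q − PQ̃) ≤ m + k`); the minimax errors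
  `minimaxErr n f w a b = inf {e | ∃ q, deg q ≤ n, |w (f − q)| ≤ e on [a, b]}` and `minimaxErrRat m k f w a b`, and
  the BRACKETS `minimaxErr_mem_Icc` / `minimaxErrRat_mem_Icc`: alternation data inside `[a, b]` with modulus `≥ δ`
  and a uniform bound `Δ` for the same approximant give `δ ≤ E ≤ Δ`.
* Part B — the KERNEL CERTIFICATE of alternation data for `P(ps; ·) = F.toFunP p ps` (any family, uniformly over a
  parameter box): `M.signCheck` (the point model at `x` certifies `P(ps; x) ≥ ℓ > 0`, resp. `≤ −ℓ < 0`),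
  `M.altCheckFrom` / `M.altCheck prm S p B a b ℓ sgn pts` (the points increase, lie in `[a, b]`, and carry
  certified signs alternating from `sgn`, each with modulus `≥ ℓ`); soundness `sign_of_signCheck`,
  `altSigns_of_altCheck` (`AltSigns (P(ps; ·)) xs`, `ℓ ≤ |P(ps; xᵢ)|`, `xᵢ ∈ [a, b]`).
* Part C — SUPREMUM NORMS and the assembled brackets: `abs_le_of_extremaCheck` (`|P(ps; t)| ≤ max(−mlo, xhi)` on
  `[a, b]`: the validated upper bound `u`) and `exists_le_abs_of_extremaCheck` (`∃ t, max(xlo, −mhi) ≤ |P(ps; t)|`: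
  the lower bound `ℓ`, so `‖P(ps; ·)‖_∞ ∈ [max(xlo, −mhi), max(−mlo, xhi)]`); and, for an ERROR PROGRAM `pD` with
  `P_D(ps; x) = w(x)·(f(x) − p(x))` on `[a, b]` (an identification hypothesis discharged by `simp` for concrete
  programs; `polyOf g` with `eval_polyOf` / `natDegree_polyOf_le` bridges the lane's coefficient lists `Poly` to
  `Polynomial ℝ`), `minimaxErr_bounds_of_checks`: ONE alternation certificate and ONE extrema certificate give
  `ℓ ≤ E_n(f; w; [a, b]) ≤ max(−mlo, xhi)`, the pointwise lower bound against every competitor and the uniform upper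
  bound for `p`; `minimaxErrRat_bounds_of_checks` likewise for `P/Q` against `R_{m,k}`.

Worked end to end (scratch kept OUT of the tree, `Certquad.ScratchMinimax`, one file: rc 0, 116 s wall, axioms
`propext`, `Classical.choice`, `Quot.sound`; see the lane records).  The approximants and their alternation points
are PROPOSED by an untrusted offline Remez iteration (60-digit decimal arithmetic, rounded to dyadics); `ℓ` is read
off the certified point enclosures and `u = max(−mlo, xhi)` off the extrema certificate; every certificate is ONE
`decide +kernel` (the `log` extrema certificate in three pieces, `extremaCheck_of_parts`).  (1) `e^t` on
`[−1, 1]`, degree 5, absolute error (`S = 2^64`; 7 point models, 18 leaves):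
`ℓ = 833894509221359·2⁻⁶⁴ ≤ E_5(exp; [−1, 1]) ≤ 833894509222895·2⁻⁶⁴ = u`, i.e.
`4.5205511926076·10⁻⁵ < E_5 < 4.5205511926160·10⁻⁵`, `u/ℓ − 1 < 1.85·10⁻¹²`; WITH the two readings that matter
to a client: every quintic `q` has `|e^x − q(x)| ≥ ℓ` at some `x ∈ [−1, 1]`, and the proposed quintic has
`|e^x − p(x)| ≤ u` for all `x ∈ [−1, 1]`; one more unit `2⁻⁶⁴` in `ℓ` is refused by the kernel.  (2) RELATIVE
error (the table-maker's setting): `e^t` on `[−1/8, 1/8]`, degree 4, weight `e^{−t}` (`S = 2^76`; 6 point models,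
14 leaves): `1200308504086740·2⁻⁷⁶ ≤ E_4(exp; e^{−t}; [−1/8, 1/8]) ≤ 600154252043705·2⁻⁷⁵`, i.e.
`1.5885950778609·10⁻⁸ < E < 1.5885950778619·10⁻⁸`, `u/ℓ − 1 < 5.6·10⁻¹³` (every quartic has relative error
`|(e^x − q(x))/e^x| ≥ ℓ` somewhere, the proposed one `≤ u` everywhere).  (3) `log(1 + t)` on `[0, 1]`, degree 4
(`S = 2^64`, `Kl = 72`; 6 point models, 14 leaves): `6.0714095295575·10⁻⁵ < E_4(log(1 + ·); [0, 1]) <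
6.0714095296069·10⁻⁵`, `u/ℓ − 1 < 8.2·10⁻¹²`.

Honest framing.  These are shared numerical engines serving client cells; rigour lives in the verifiers (the
soundness theorems below, whose hypotheses are Boolean certificates decided by the kernel); every published number
belongs to a client cell's ledger, not to this module.  ANCHOR / nearest in-tree relatives: `TaylorModelExtremaCert`
(USED: `extremaCheck`, `min_of_extremaCheck` / `max_of_extremaCheck`), `TaylorModelZeroCert` (USED: `pointI`,
`mem_pointI`), `ListPolynomial` (USED: `toPoly`, `eval_toPoly`), `ExpPoly/Poly` (USED: `Poly.eval_eq_evalR`);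
`SignChangeRootIsolation.lean` (sign changes of a polynomial across EXACTLY `deg p` disjoint brackets ⇒ one simple
zero each — the complementary regime; here MORE sign changes than the degree allows ⇒ impossible; not imported);
`Approximation/ChebyshevShiftedMinimax.lean`, `Approximation/MarkovInequality.lean`,
`Approximation/InterpolationRemainder.lean` (explicit minimax statements for specific families; no de la
Vallée-Poussin theorem in the tree before this module); `GridSupBound.lean` (grid-to-continuum sup bounds from a
derivative bound; not bridged).  Deliberately NOT here: existence / uniqueness / characterisation of best
approximations (the alternation theorems of Chebyshev and Achieser, the Haar condition, the Remez algorithm and its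
convergence: cited context only — the bracket needs none of them), the defect and normality of rational best
approximations (the rational theorem is stated with `m + k + 2` points, valid regardless of the defect), relative
errors with removable singularities (op. cit. Sect. 4.4), reciprocal / square-root statements in the worked examples
(their models consume externally proposed thin candidates, which the `#eval` generators of this lane do not
produce), several variables, and any floating-point arithmetic (all certificate data are exact rationals and scaled
integers; the offline Remez step is untrusted and only PROPOSES `p` and the points).  Problem-independent; no facts,
no axioms; all certificate data computable over `ℚ` and `ℤ`.

References: [cite: HammerlinHoffman1991, Ch. 4 §4.5 Error Bound]; [cite: HammerlinHoffman1991, Ch. 4 §4.3 Definition];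
[cite: Braess1986, Ch. III Thm 3.8]; [cite: Braess1986, Ch. V Lemma 2.1 (2.2)]; [cite: Braess1986, Ch. V Thm 2.2];
[cite: ChevillardEtAl2011, Sect. 2.1 (2)]; [cite: ChevillardEtAl2011, Algorithm 3.1]; [cite: ChevillardEtAl2011, Sect. 2.3];
[cite: RatschekRokne1988, Sect. 3.11]; [cite: MakinoBerz2003, Algorithm 2]; [cite: HammerlinHoffman1991, Ch. 5 §5.1 Horner's Scheme].

AI-produced formalisation (H21 engines group, seat eng-quad-3 gen 58, 2026-08-23); no facts, no axioms, no `sorry`.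
-/

open Set Polynomial

namespace Literature.Analysis.ValidatedNumerics

namespace PolyMP

open Literature.Analysis.ValidatedNumerics.NumericsMP
open Literature.Analysis.ValidatedNumerics.ExpPoly (Poly)
open Literature.Analysis.ValidatedNumerics.ExpPoly

/-! ### Part A. De la Vallée-Poussin's theorem over `ℝ` (weighted; polynomial and rational) -/

/-- **Alternation data** of `g` on the points `xs`: consecutive points increase and carry values of `g` of strictly
opposite signs, `xᵢ < xᵢ₊₁ ∧ g(xᵢ)·g(xᵢ₊₁) < 0` (an alternant in the sense of op. cit., with no reference to `‖g‖`).
[cite: HammerlinHoffman1991, Ch. 4 §4.3 Definition] -/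
def AltSigns (g : ℝ → ℝ) (xs : List ℝ) : Prop :=
  xs.IsChain (fun x y => x < y ∧ g x * g y < 0)

/-- A real polynomial with values of opposite signs at `x < y` vanishes strictly between (intermediate value theorem).
[folklore] -/
private theorem exists_eval_eq_zero_of_mul_neg (P : ℝ[X]) {x y : ℝ} (hxy : x < y)
    (hs : P.eval x * P.eval y < 0) : ∃ r ∈ Ioo x y, P.eval r = 0 := by
  have hcont : ContinuousOn (fun t => P.eval t) (Icc x y) := P.continuous.continuousOn
  rcases mul_neg_iff.1 hs with ⟨hx, hy⟩ | ⟨hx, hy⟩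
  · exact intermediate_value_Ioo' hxy.le hcont ⟨hy, hx⟩
  · exact intermediate_value_Ioo hxy.le hcont ⟨hx, hy⟩

/-- The zeros in the gaps of alternation data of a polynomial, from the first point on, in increasing order.
[folklore] -/
private theorem exists_roots_of_altSigns (P : ℝ[X]) :
    ∀ (x : ℝ) (rest : List ℝ), AltSigns (fun t => P.eval t) (x :: rest) →
      ∃ rs : List ℝ, rs.length = rest.length ∧ (∀ r ∈ rs, x < r ∧ P.eval r = 0) ∧ rs.Pairwise (· < ·)
  | x, [], _ => ⟨[], rfl, fun r hr => absurd hr (by simp), List.Pairwise.nil⟩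
  | x, y :: rest, h => by
      obtain ⟨hxy, hrest⟩ := List.isChain_cons_cons.1 h
      obtain ⟨rs, hlen, hrs, hpw⟩ := exists_roots_of_altSigns P y rest hrest
      obtain ⟨r, hr, hr0⟩ := exists_eval_eq_zero_of_mul_neg P hxy.1 hxy.2
      refine ⟨r :: rs, by rw [List.length_cons, List.length_cons, hlen], ?_, ?_⟩
      · intro r' hr'
        rcases List.mem_cons.1 hr' with rfl | hm
        · exact ⟨hr.1, hr0⟩
        · exact ⟨hxy.1.trans (hrs r' hm).1, (hrs r' hm).2⟩
      · exact List.pairwise_cons.2 ⟨fun r' hm => hr.2.trans (hrs r' hm).1, hpw⟩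

/-- **No real polynomial of degree `≤ N` alternates in sign on `N + 2` ordered points**: the intermediate value
theorem puts a zero in each of the `N + 1` gaps, a polynomial with more zeros than its degree is `0`, and `0` does
not alternate.  The counting step of de la Vallée-Poussin's theorem (Property Z of the polynomials).
[cite: HammerlinHoffman1991, Ch. 4 §4.5 Error Bound] [cite: Braess1986, Ch. III Thm 3.8] -/
theorem not_altSigns_of_natDegree_lt (P : ℝ[X]) {xs : List ℝ} (hlen : P.natDegree + 2 ≤ xs.length) :
    ¬ AltSigns (fun t => P.eval t) xs := by
  intro h
  rcases xs with _ | ⟨x, _ | ⟨y, rest⟩⟩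
  · simp only [List.length_nil] at hlen; omega
  · simp only [List.length_cons, List.length_nil] at hlen; omega
  · obtain ⟨⟨-, hs⟩, -⟩ := List.isChain_cons_cons.1 h
    obtain ⟨rs, hlen', hrs, hpw⟩ := exists_roots_of_altSigns P x (y :: rest) h
    have hnd : rs.Nodup := hpw.imp ne_of_lt
    have hP : P = 0 := by
      refine Polynomial.eq_zero_of_natDegree_lt_card_of_eval_eq_zero' P rs.toFinset
        (fun r hr => (hrs r (List.mem_toFinset.1 hr)).2) ?_
      rw [List.toFinset_card_of_nodup hnd, hlen']
      simp only [List.length_cons] at hlen ⊢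
      omega
    rw [hP] at hs
    simp at hs

/-- Sign transfer: if `g₁·g₂ < 0` and `|hᵢ| < |gᵢ|`, then `(g₁ − h₁)·(g₂ − h₂) < 0`. [folklore] -/
private theorem mul_neg_of_abs_lt {g₁ g₂ h₁ h₂ : ℝ} (hg : g₁ * g₂ < 0) (h₁' : |h₁| < |g₁|) (h₂' : |h₂| < |g₂|) :
    (g₁ - h₁) * (g₂ - h₂) < 0 := by
  rcases mul_neg_iff.1 hg with ⟨hp, hn⟩ | ⟨hn, hp⟩
  · rw [abs_of_pos hp] at h₁'
    rw [abs_of_neg hn] at h₂'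
    obtain ⟨-, a2⟩ := abs_lt.1 h₁'
    obtain ⟨b1, -⟩ := abs_lt.1 h₂'
    exact mul_neg_of_pos_of_neg (by linarith) (by linarith)
  · rw [abs_of_neg hn] at h₁'
    rw [abs_of_pos hp] at h₂'
    obtain ⟨a1, -⟩ := abs_lt.1 h₁'
    obtain ⟨-, b2⟩ := abs_lt.1 h₂'
    exact mul_neg_of_neg_of_pos (by linarith) (by linarith)

/-- Positive factors do not change the sign of a product. [folklore] -/
private theorem mul_neg_of_pos_mul_neg {c d u v : ℝ} (hc : 0 < c) (hd : 0 < d) (h : (c * u) * (d * v) < 0) :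
    u * v < 0 := by
  rw [show (c * u) * (d * v) = (c * d) * (u * v) by ring] at h
  rcases mul_neg_iff.1 h with ⟨-, huv⟩ | ⟨hcd, -⟩
  · exact huv
  · exact absurd hcd (not_lt.2 (mul_pos hc hd).le)

/-- **De la Vallée-Poussin's theorem, weighted polynomial approximation.**  If the weighted error `w·(f − p)` of a
polynomial `p` of degree `≤ n` alternates in sign on `n + 2` ordered points, where the weight is positive and the
modulus of the error is at least `δ`, then EVERY polynomial `q` of degree `≤ n` has weighted error of modulus at
least `δ` at one of the points (else `w·(q − p)`, hence `q − p`, would alternate on `n + 2` points).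
[cite: HammerlinHoffman1991, Ch. 4 §4.5 Error Bound] [cite: Braess1986, Ch. III Thm 3.8] -/
theorem exists_le_abs_of_altSigns {f w : ℝ → ℝ} {p : ℝ[X]} {n : ℕ} {xs : List ℝ} {δ : ℝ}
    (halt : AltSigns (fun x => w x * (f x - p.eval x)) xs) (hδ : ∀ x ∈ xs, δ ≤ |w x * (f x - p.eval x)|)
    (hw : ∀ x ∈ xs, 0 < w x) (hp : p.natDegree ≤ n) (hlen : n + 2 ≤ xs.length)
    (q : ℝ[X]) (hq : q.natDegree ≤ n) : ∃ x ∈ xs, δ ≤ |w x * (f x - q.eval x)| := by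
  by_contra hcon
  push Not at hcon
  have hdeg : (q - p).natDegree + 2 ≤ xs.length := by
    have h1 := natDegree_sub_le q p
    have hm : max q.natDegree p.natDegree ≤ n := max_le hq hp
    omega
  refine not_altSigns_of_natDegree_lt (q - p) hdeg ?_
  unfold AltSigns at halt ⊢
  refine List.IsChain.imp_of_mem_imp (fun a b ha hb hab => ⟨hab.1, ?_⟩) halt
  have h1 := mul_neg_of_abs_lt hab.2 ((hcon a ha).trans_le (hδ a ha)) ((hcon b hb).trans_le (hδ b hb))
  have e : ∀ x, w x * (f x - p.eval x) - w x * (f x - q.eval x) = w x * (q - p).eval x := by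
    intro x; rw [eval_sub]; ring
  rw [e, e] at h1
  exact mul_neg_of_pos_mul_neg (hw a ha) (hw b hb) h1

/-- **De la Vallée-Poussin's theorem, weighted rational approximation** from
`R_{m,k} = {P̃/Q̃ : deg P̃ ≤ m, deg Q̃ ≤ k, Q̃ > 0}`.  If the weighted error `w·(f − P/Q)` of `P/Q ∈ R_{m,k}`
alternates in sign on `m + k + 2` ordered points where `w > 0`, `Q > 0` and its modulus is at least `δ`, then every
`P̃/Q̃ ∈ R_{m,k}` with `Q̃ > 0` at the points has weighted error of modulus at least `δ` at one of them: Property Z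
of the rational functions, `P̃/Q̃ − P/Q = (P̃Q − PQ̃)/(QQ̃)` with `deg (P̃Q − PQ̃) ≤ m + k` (stated with
`m + k + 2` points — at least the `m + k + 2 − d` of the defect-aware form, so valid for every `P/Q`).
[cite: Braess1986, Ch. III Thm 3.8] [cite: Braess1986, Ch. V Lemma 2.1 (2.2)] -/
theorem exists_le_abs_of_altSigns_rat {f w : ℝ → ℝ} {p q : ℝ[X]} {m k : ℕ} {xs : List ℝ} {δ : ℝ}
    (halt : AltSigns (fun x => w x * (f x - p.eval x / q.eval x)) xs)
    (hδ : ∀ x ∈ xs, δ ≤ |w x * (f x - p.eval x / q.eval x)|) (hw : ∀ x ∈ xs, 0 < w x)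
    (hp : p.natDegree ≤ m) (hq : q.natDegree ≤ k) (hqpos : ∀ x ∈ xs, 0 < q.eval x)
    (hlen : m + k + 2 ≤ xs.length) (p' q' : ℝ[X]) (hp' : p'.natDegree ≤ m) (hq' : q'.natDegree ≤ k)
    (hq'pos : ∀ x ∈ xs, 0 < q'.eval x) : ∃ x ∈ xs, δ ≤ |w x * (f x - p'.eval x / q'.eval x)| := by
  by_contra hcon
  push Not at hcon
  have hdeg : (p' * q - p * q').natDegree + 2 ≤ xs.length := by
    have h1 : (p' * q).natDegree ≤ m + k := natDegree_mul_le.trans (add_le_add hp' hq)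
    have h2 : (p * q').natDegree ≤ m + k := natDegree_mul_le.trans (add_le_add hp hq')
    have h3 := natDegree_sub_le (p' * q) (p * q')
    have hm : max (p' * q).natDegree (p * q').natDegree ≤ m + k := max_le h1 h2
    omega
  refine not_altSigns_of_natDegree_lt _ hdeg ?_
  unfold AltSigns at halt ⊢
  refine List.IsChain.imp_of_mem_imp (fun a b ha hb hab => ⟨hab.1, ?_⟩) halt
  have h1 := mul_neg_of_abs_lt hab.2 ((hcon a ha).trans_le (hδ a ha)) ((hcon b hb).trans_le (hδ b hb))
  have e : ∀ x ∈ xs, w x * (f x - p.eval x / q.eval x) - w x * (f x - p'.eval x / q'.eval x) =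
      (w x / (q.eval x * q'.eval x)) * (p' * q - p * q').eval x := by
    intro x hx
    have hq0 : q.eval x ≠ 0 := (hqpos x hx).ne'
    have hq0' : q'.eval x ≠ 0 := (hq'pos x hx).ne'
    rw [eval_sub, eval_mul, eval_mul]
    field_simp
    ring
  rw [e a ha, e b hb] at h1
  exact mul_neg_of_pos_mul_neg (div_pos (hw a ha) (mul_pos (hqpos a ha) (hq'pos a ha)))
    (div_pos (hw b hb) (mul_pos (hqpos b hb) (hq'pos b hb))) h1

/-- **The weighted minimax error** `E_n(f; w; [a, b]) = inf_{deg q ≤ n} sup_{x ∈ [a, b]} |w(x)(f(x) − q(x))|`, as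
the infimum of the admissible uniform bounds (`sInf`; the bracket below supplies nonemptiness and boundedness).
[cite: HammerlinHoffman1991, Ch. 4 §4.5 Error Bound] -/
noncomputable def minimaxErr (n : ℕ) (f w : ℝ → ℝ) (a b : ℝ) : ℝ :=
  sInf {e : ℝ | ∃ q : ℝ[X], q.natDegree ≤ n ∧ ∀ x ∈ Icc a b, |w x * (f x - q.eval x)| ≤ e}

/-- **The weighted rational minimax error** `E_{m,k}(f; w; [a, b])` over
`R_{m,k}[a, b] = {P̃/Q̃ : deg P̃ ≤ m, deg Q̃ ≤ k, Q̃ > 0 on [a, b]}`. [cite: Braess1986, Ch. V Thm 2.2] -/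
noncomputable def minimaxErrRat (m k : ℕ) (f w : ℝ → ℝ) (a b : ℝ) : ℝ :=
  sInf {e : ℝ | ∃ p q : ℝ[X], p.natDegree ≤ m ∧ q.natDegree ≤ k ∧ (∀ x ∈ Icc a b, 0 < q.eval x) ∧
    ∀ x ∈ Icc a b, |w x * (f x - p.eval x / q.eval x)| ≤ e}

/-- **The de la Vallée-Poussin bracket** `δ ≤ E_n(f; w; [a, b]) ≤ Δ`: alternation data of `w·(f − p)` inside
`[a, b]` on `n + 2` points with modulus `≥ δ`, `deg p ≤ n`, `w > 0` at the points, and a uniform bound `Δ` of the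
same weighted error on `[a, b]`. [cite: HammerlinHoffman1991, Ch. 4 §4.5 Error Bound] -/
theorem minimaxErr_mem_Icc {n : ℕ} {f w : ℝ → ℝ} {a b : ℝ} {p : ℝ[X]} {xs : List ℝ} {δ Δ : ℝ}
    (halt : AltSigns (fun x => w x * (f x - p.eval x)) xs) (hδ : ∀ x ∈ xs, δ ≤ |w x * (f x - p.eval x)|)
    (hw : ∀ x ∈ xs, 0 < w x) (hp : p.natDegree ≤ n) (hlen : n + 2 ≤ xs.length) (hxs : ∀ x ∈ xs, x ∈ Icc a b)
    (hΔ : ∀ x ∈ Icc a b, |w x * (f x - p.eval x)| ≤ Δ) :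
    δ ≤ minimaxErr n f w a b ∧ minimaxErr n f w a b ≤ Δ := by
  unfold minimaxErr
  have hlb : ∀ e ∈ {e : ℝ | ∃ q : ℝ[X], q.natDegree ≤ n ∧ ∀ x ∈ Icc a b, |w x * (f x - q.eval x)| ≤ e}, δ ≤ e := by
    rintro e ⟨q, hq, he⟩
    obtain ⟨x, hx, hδx⟩ := exists_le_abs_of_altSigns halt hδ hw hp hlen q hq
    exact hδx.trans (he x (hxs x hx))
  exact ⟨le_csInf ⟨Δ, p, hp, hΔ⟩ hlb, csInf_le ⟨δ, fun e he => hlb e he⟩ ⟨p, hp, hΔ⟩⟩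

/-- **The de la Vallée-Poussin bracket for rational approximation** `δ ≤ E_{m,k}(f; w; [a, b]) ≤ Δ`.
[cite: Braess1986, Ch. III Thm 3.8] [cite: Braess1986, Ch. V Lemma 2.1 (2.2)] -/
theorem minimaxErrRat_mem_Icc {m k : ℕ} {f w : ℝ → ℝ} {a b : ℝ} {p q : ℝ[X]} {xs : List ℝ} {δ Δ : ℝ}
    (halt : AltSigns (fun x => w x * (f x - p.eval x / q.eval x)) xs)
    (hδ : ∀ x ∈ xs, δ ≤ |w x * (f x - p.eval x / q.eval x)|) (hw : ∀ x ∈ xs, 0 < w x)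
    (hp : p.natDegree ≤ m) (hq : q.natDegree ≤ k) (hqpos : ∀ x ∈ Icc a b, 0 < q.eval x)
    (hlen : m + k + 2 ≤ xs.length) (hxs : ∀ x ∈ xs, x ∈ Icc a b)
    (hΔ : ∀ x ∈ Icc a b, |w x * (f x - p.eval x / q.eval x)| ≤ Δ) :
    δ ≤ minimaxErrRat m k f w a b ∧ minimaxErrRat m k f w a b ≤ Δ := by
  unfold minimaxErrRat
  have hlb : ∀ e ∈ {e : ℝ | ∃ p q : ℝ[X], p.natDegree ≤ m ∧ q.natDegree ≤ k ∧ (∀ x ∈ Icc a b, 0 < q.eval x) ∧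
      ∀ x ∈ Icc a b, |w x * (f x - p.eval x / q.eval x)| ≤ e}, δ ≤ e := by
    rintro e ⟨p', q', hp', hq', hq'pos, he⟩
    obtain ⟨x, hx, hδx⟩ := exists_le_abs_of_altSigns_rat halt hδ hw hp hq (fun x hx => hqpos x (hxs x hx)) hlen
      p' q' hp' hq' (fun x hx => hq'pos x (hxs x hx))
    exact hδx.trans (he x (hxs x hx))
  exact ⟨le_csInf ⟨Δ, p, q, hp, hq, hqpos, hΔ⟩ hlb, csInf_le ⟨δ, fun e he => hlb e he⟩ ⟨p, q, hp, hq, hqpos, hΔ⟩⟩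

/-- **Coefficient lists as real polynomials**: the Mathlib polynomial of the rational coefficient list `g`
(bridge from the lane's exact lists `Poly` — the `SOp.poly` statement — to `Polynomial ℝ`). [folklore] -/
noncomputable def polyOf (g : Poly) : ℝ[X] := toPoly (g.map ((↑) : ℚ → ℝ))

/-- `polyOf g` is the polynomial `a₀ + a₁x + ⋯ + aₙxⁿ` of the coefficient list `g = [a₀, …, aₙ]`: its value at `x`
is the Horner value `Poly.eval g x` computed by the lane. [cite: HammerlinHoffman1991, Ch. 5 §5.1 Horner's Scheme] -/
theorem eval_polyOf (g : Poly) (x : ℝ) : (polyOf g).eval x = Poly.eval g x := by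
  rw [polyOf, eval_toPoly, ← Poly.eval_eq_evalR]

/-- `deg (polyOf g) ≤ |g| − 1`: the polynomial `a₀ + a₁x + ⋯ + aₙxⁿ` of a list of `n + 1` coefficients lies in
`P_n`. [cite: HammerlinHoffman1991, Ch. 5 §5.1 Horner's Scheme] -/
theorem natDegree_polyOf_le (g : Poly) : (polyOf g).natDegree ≤ g.length - 1 := by
  rw [polyOf, Polynomial.natDegree_le_iff_coeff_eq_zero]
  intro N hN
  rw [coeff_toPoly, List.getD_eq_default _ _ (by rw [List.length_map]; omega)]

/-! ### Part B. The kernel certificate of alternation data: certified signs and moduli of point values -/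

namespace OpModel

variable (M : OpModel)

/-- **The certified sign and modulus of a point value**: from the point model `P(ps; x)·S ∈ [Y̲, Ȳ]` of `p` at `x`
(candidates `cs`), accept `sgn = true` when `0 < Y̲` and `ℓ·S ≤ Y̲` (so `P(ps; x) > 0` and `≥ ℓ`), `sgn = false` when
`Ȳ < 0` and `Ȳ ≤ −ℓ·S`. [cite: MakinoBerz2003, Algorithm 2] [cite: ChevillardEtAl2011, Sect. 2.1 (2)] -/
def signCheck (prm : M.Prm) (S : ℕ) (p : GProg M) (B : PBox) (ℓ : ℚ) (sgn : Bool) (x : ℚ)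
    (cs : List (List ℤ × ℕ)) : Bool :=
  let Y := M.pointI prm S p B x cs
  Y.2 && (bif sgn then decide (0 < Y.1.lo) && decide (ℓ * S ≤ ((Y.1.lo : ℤ) : ℚ))
    else decide (Y.1.hi < 0) && decide (((Y.1.hi : ℤ) : ℚ) ≤ -(ℓ * S)))

/-- **The alternation certificate from a point on**: given the previous point `x` with certified sign `sgn`, every
further point is larger and carries the opposite certified sign with modulus `≥ ℓ`.
[cite: HammerlinHoffman1991, Ch. 4 §4.3 Definition] [cite: MakinoBerz2003, Algorithm 2] -/
def altCheckFrom (prm : M.Prm) (S : ℕ) (p : GProg M) (B : PBox) (ℓ : ℚ) :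
    ℚ → Bool → List (ℚ × List (List ℤ × ℕ)) → Bool
  | _, _, [] => true
  | x, sgn, (y, cs) :: rest =>
      decide (x < y) && M.signCheck prm S p B ℓ (!sgn) y cs && altCheckFrom prm S p B ℓ y (!sgn) rest

/-- **The alternation certificate** of `P(ps; ·)` on the points `pts` (each with the candidates of its point model):
`0 < S`, every point in `[a, b]`, the first point with certified sign `sgn`, the signs alternating along increasing
points, every modulus `≥ ℓ`.  One `decide +kernel` decides it.
[cite: HammerlinHoffman1991, Ch. 4 §4.3 Definition] [cite: MakinoBerz2003, Algorithm 2] -/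
def altCheck (prm : M.Prm) (S : ℕ) (p : GProg M) (B : PBox) (a b ℓ : ℚ) (sgn : Bool)
    (pts : List (ℚ × List (List ℤ × ℕ))) : Bool :=
  decide (0 < S) && (pts.all fun e => decide (a ≤ e.1) && decide (e.1 ≤ b)) &&
    (match pts with
      | [] => true
      | (x, cs) :: rest => M.signCheck prm S p B ℓ sgn x cs && M.altCheckFrom prm S p B ℓ x sgn rest)

end OpModel

namespace OpSem

variable {M : OpModel} (F : OpSem M)

/-- **Soundness of the certified sign**: `ℓ ≤ |P(ps; x)|`, and `P(ps; x) > 0` (`sgn = true`) / `< 0` (`sgn = false`),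
for every parameter vector of the box. [cite: MakinoBerz2003, Algorithm 2] [cite: ChevillardEtAl2011, Sect. 2.1 (2)] -/
theorem sign_of_signCheck {prm : M.Prm} {S : ℕ} (hS : 0 < S) {p : GProg M} {B : PBox} {ℓ : ℚ} {sgn : Bool}
    {x : ℚ} {cs : List (List ℤ × ℕ)} (h : M.signCheck prm S p B ℓ sgn x cs = true) {ps : List ℝ}
    (hB : BoxMem ps B) :
    ((ℓ : ℚ) : ℝ) ≤ |F.toFunP p ps x| ∧ (sgn = true → 0 < F.toFunP p ps x) ∧
      (sgn = false → F.toFunP p ps x < 0) := by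
  unfold OpModel.signCheck at h
  simp only [Bool.and_eq_true] at h
  obtain ⟨hok, hsg⟩ := h
  have hm := F.mem_pointI hS hok hB
  unfold MI.mem at hm
  obtain ⟨hlo, hhi⟩ := hm
  have hSr : (0 : ℝ) < S := by exact_mod_cast hS
  cases sgn
  · simp only [cond_false, Bool.and_eq_true, decide_eq_true_eq] at hsg
    obtain ⟨hhi0, hhiℓ⟩ := hsg
    have hhi0' : (((M.pointI prm S p B x cs).1.hi : ℤ) : ℝ) < 0 := by exact_mod_cast hhi0
    have hhiℓ' : (((M.pointI prm S p B x cs).1.hi : ℤ) : ℝ) ≤ -(((ℓ : ℚ) : ℝ) * S) := by exact_mod_cast hhiℓ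
    have hneg : F.toFunP p ps x < 0 := by
      by_contra hcon
      push Not at hcon
      have : 0 ≤ F.toFunP p ps x * S := mul_nonneg hcon hSr.le
      linarith
    refine ⟨?_, fun h => absurd h (by decide), fun _ => hneg⟩
    rw [abs_of_neg hneg]
    have h1 : ((ℓ : ℚ) : ℝ) * S ≤ (-F.toFunP p ps x) * S := by linarith
    exact le_of_mul_le_mul_right h1 hSr
  · simp only [cond_true, Bool.and_eq_true, decide_eq_true_eq] at hsg
    obtain ⟨hlo0, hloℓ⟩ := hsg
    have hlo0' : (0 : ℝ) < (((M.pointI prm S p B x cs).1.lo : ℤ) : ℝ) := by exact_mod_cast hlo0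
    have hloℓ' : ((ℓ : ℚ) : ℝ) * S ≤ (((M.pointI prm S p B x cs).1.lo : ℤ) : ℝ) := by exact_mod_cast hloℓ
    have hpos : 0 < F.toFunP p ps x := by
      by_contra hcon
      push Not at hcon
      have : F.toFunP p ps x * S ≤ 0 := mul_nonpos_of_nonpos_of_nonneg hcon hSr.le
      linarith
    refine ⟨?_, fun _ => hpos, fun h => absurd h (by decide)⟩
    rw [abs_of_pos hpos]
    exact le_of_mul_le_mul_right (hloℓ'.trans hlo) hSr

/-- Soundness of `altCheckFrom`: alternation data from the previous point on, and the moduli. [folklore] -/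
private theorem altSigns_of_altCheckFrom {prm : M.Prm} {S : ℕ} (hS : 0 < S) {p : GProg M} {B : PBox} {ℓ : ℚ}
    {ps : List ℝ} (hB : BoxMem ps B) :
    ∀ (x : ℚ) (sgn : Bool) (rest : List (ℚ × List (List ℤ × ℕ))),
      M.altCheckFrom prm S p B ℓ x sgn rest = true →
      ((sgn = true → 0 < F.toFunP p ps x) ∧ (sgn = false → F.toFunP p ps x < 0)) →
        List.IsChain (fun u v : ℝ => u < v ∧ F.toFunP p ps u * F.toFunP p ps v < 0)
            (((x : ℚ) : ℝ) :: rest.map fun e => ((e.1 : ℚ) : ℝ)) ∧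
          ∀ e ∈ rest, ((ℓ : ℚ) : ℝ) ≤ |F.toFunP p ps e.1|
  | x, sgn, [], _, _ => ⟨by simp, fun e he => absurd he (by simp)⟩
  | x, sgn, (y, cs) :: rest, h, hx => by
      rw [OpModel.altCheckFrom] at h
      simp only [Bool.and_eq_true, decide_eq_true_eq] at h
      obtain ⟨⟨hxy, hsc⟩, hrest⟩ := h
      obtain ⟨hℓy, hpos, hneg⟩ := F.sign_of_signCheck hS hsc hB
      obtain ⟨hch, hℓ⟩ := altSigns_of_altCheckFrom hS hB y (!sgn) rest hrest ⟨hpos, hneg⟩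
      refine ⟨?_, ?_⟩
      · rw [List.map_cons]
        refine List.IsChain.cons_cons ⟨by exact_mod_cast hxy, ?_⟩ hch
        cases sgn
        · exact mul_neg_of_neg_of_pos (hx.2 rfl) (hpos rfl)
        · exact mul_neg_of_pos_of_neg (hx.1 rfl) (hneg rfl)
      · intro e he
        rcases List.mem_cons.1 he with rfl | hm
        · exact hℓy
        · exact hℓ e hm

/-- **Soundness of the alternation certificate**: the points, as reals, are alternation data of `P(ps; ·)`
(increasing, values of strictly alternating signs), every modulus is at least `ℓ`, and every point lies in
`[a, b]` — for every parameter vector of the box. [cite: HammerlinHoffman1991, Ch. 4 §4.3 Definition] [cite: MakinoBerz2003, Algorithm 2] -/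
theorem altSigns_of_altCheck {prm : M.Prm} {S : ℕ} {p : GProg M} {B : PBox} {a b ℓ : ℚ} {sgn : Bool}
    {pts : List (ℚ × List (List ℤ × ℕ))} (h : M.altCheck prm S p B a b ℓ sgn pts = true) {ps : List ℝ}
    (hB : BoxMem ps B) :
    AltSigns (F.toFunP p ps) (pts.map fun e => ((e.1 : ℚ) : ℝ)) ∧
      (∀ x ∈ pts.map (fun e => ((e.1 : ℚ) : ℝ)), ((ℓ : ℚ) : ℝ) ≤ |F.toFunP p ps x|) ∧
      ∀ x ∈ pts.map (fun e => ((e.1 : ℚ) : ℝ)), x ∈ Icc ((a : ℚ) : ℝ) ((b : ℚ) : ℝ) := by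
  unfold OpModel.altCheck at h
  simp only [Bool.and_eq_true, decide_eq_true_eq, List.all_eq_true] at h
  obtain ⟨⟨hS, hab⟩, hmain⟩ := h
  refine ⟨?_, ?_, ?_⟩
  · rcases pts with _ | ⟨⟨x, cs⟩, rest⟩
    · exact List.IsChain.nil
    · simp only [Bool.and_eq_true] at hmain
      obtain ⟨hsc, hrest⟩ := hmain
      obtain ⟨-, hpos, hneg⟩ := F.sign_of_signCheck hS hsc hB
      exact (F.altSigns_of_altCheckFrom hS hB x sgn rest hrest ⟨hpos, hneg⟩).1
  · rcases pts with _ | ⟨⟨x, cs⟩, rest⟩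
    · intro x hx; exact absurd hx (by simp)
    · simp only [Bool.and_eq_true] at hmain
      obtain ⟨hsc, hrest⟩ := hmain
      obtain ⟨hℓx, hpos, hneg⟩ := F.sign_of_signCheck hS hsc hB
      have hℓ := (F.altSigns_of_altCheckFrom hS hB x sgn rest hrest ⟨hpos, hneg⟩).2
      intro z hz
      rw [List.map_cons, List.mem_cons, List.mem_map] at hz
      rcases hz with rfl | ⟨e, he, rfl⟩
      · exact hℓx
      · exact hℓ e he
  · intro z hz
    rw [List.mem_map] at hz
    obtain ⟨e, he, rfl⟩ := hz
    obtain ⟨h1, h2⟩ := hab e he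
    exact ⟨by exact_mod_cast h1, by exact_mod_cast h2⟩

end OpSem

/-! ### Part C. Supremum norms from the extrema certificate; the assembled minimax brackets -/

namespace OpTangent

variable {M : OpModel} {F : OpSem M} (T : OpTangent M F)

/-- **The supremum norm, validated upper bound**: `|P(ps; t)| ≤ max(−mlo, xhi)` on `[a, b]` (the global minimum is
at least `mlo` and the global maximum at most `xhi`). [cite: ChevillardEtAl2011, Sect. 2.3] [cite: RatschekRokne1988, Sect. 3.11] -/
theorem abs_le_of_extremaCheck {prm : M.Prm} {S : ℕ} {p : GProg M} {B : PBox} {a b : ℚ} {C : ECert}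
    (hc : T.extremaCheck prm S p B a b C = true) {ps : List ℝ} (hB : BoxMem ps B) :
    ∀ t ∈ Icc ((a : ℚ) : ℝ) ((b : ℚ) : ℝ), |F.toFunP p ps t| ≤ max (-((C.mlo : ℚ) : ℝ)) ((C.xhi : ℚ) : ℝ) := by
  intro t ht
  have h1 := (T.min_of_extremaCheck hc hB).1 t ht
  have h2 := (T.max_of_extremaCheck hc hB).1 t ht
  rw [abs_le]
  constructor
  · have h3 := le_max_left (-((C.mlo : ℚ) : ℝ)) ((C.xhi : ℚ) : ℝ)
    linarith
  · exact h2.trans (le_max_right _ _)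

/-- **The supremum norm, lower bound**: some value on `[a, b]` has modulus at least `max(xlo, −mhi)` (the maximum
is attained above `xlo`, the minimum below `mhi`); with the upper bound, `‖P(ps; ·)‖_{∞,[a,b]} ∈
[max(xlo, −mhi), max(−mlo, xhi)]`. [cite: ChevillardEtAl2011, Sect. 2.3] [cite: RatschekRokne1988, Sect. 3.11] -/
theorem exists_le_abs_of_extremaCheck {prm : M.Prm} {S : ℕ} {p : GProg M} {B : PBox} {a b : ℚ} {C : ECert}
    (hc : T.extremaCheck prm S p B a b C = true) {ps : List ℝ} (hB : BoxMem ps B) :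
    ∃ t ∈ Icc ((a : ℚ) : ℝ) ((b : ℚ) : ℝ), max ((C.xlo : ℚ) : ℝ) (-((C.mhi : ℚ) : ℝ)) ≤ |F.toFunP p ps t| := by
  rcases le_total ((C.xlo : ℚ) : ℝ) (-((C.mhi : ℚ) : ℝ)) with h | h
  · obtain ⟨t, ht, hle⟩ := (T.min_of_extremaCheck hc hB).2
    refine ⟨t, ht, ?_⟩
    rw [max_eq_right h]
    linarith [neg_le_abs (F.toFunP p ps t)]
  · obtain ⟨t, ht, hle⟩ := (T.max_of_extremaCheck hc hB).2
    refine ⟨t, ht, ?_⟩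
    rw [max_eq_left h]
    exact hle.trans (le_abs_self _)

/-- **Certified bracket of the weighted polynomial minimax error.**  For an error program `pD` denoting
`w·(f − p)` on `[a, b]` (`deg p ≤ n`, `w > 0`), ONE alternation certificate (`n + 2` points, modulus `ℓ`) and ONE
extrema certificate give: `ℓ ≤ E_n(f; w; [a, b]) ≤ max(−mlo, xhi)`; every polynomial of degree `≤ n` has weighted
error `≥ ℓ` somewhere on `[a, b]`; and `|w (f − p)| ≤ max(−mlo, xhi)` on `[a, b]` — for every parameter vector of
the box. [cite: HammerlinHoffman1991, Ch. 4 §4.5 Error Bound] [cite: ChevillardEtAl2011, Algorithm 3.1] -/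
theorem minimaxErr_bounds_of_checks {prm : M.Prm} {S : ℕ} {pD : GProg M} {B : PBox} {a b ℓ : ℚ} {sgn : Bool}
    {pts : List (ℚ × List (List ℤ × ℕ))} {C : ECert} (hA : M.altCheck prm S pD B a b ℓ sgn pts = true)
    (hE : T.extremaCheck prm S pD B a b C = true) {ps : List ℝ} (hB : BoxMem ps B) {f w : ℝ → ℝ} {p : ℝ[X]}
    {n : ℕ} (hp : p.natDegree ≤ n) (hlen : n + 2 ≤ pts.length) (hw : ∀ x ∈ Icc ((a : ℚ) : ℝ) ((b : ℚ) : ℝ), 0 < w x)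
    (hD : ∀ x ∈ Icc ((a : ℚ) : ℝ) ((b : ℚ) : ℝ), F.toFunP pD ps x = w x * (f x - p.eval x)) :
    ((ℓ : ℚ) : ℝ) ≤ minimaxErr n f w a b ∧ minimaxErr n f w a b ≤ max (-((C.mlo : ℚ) : ℝ)) ((C.xhi : ℚ) : ℝ) ∧
      (∀ q : ℝ[X], q.natDegree ≤ n →
        ∃ x ∈ Icc ((a : ℚ) : ℝ) ((b : ℚ) : ℝ), ((ℓ : ℚ) : ℝ) ≤ |w x * (f x - q.eval x)|) ∧
      ∀ x ∈ Icc ((a : ℚ) : ℝ) ((b : ℚ) : ℝ), |w x * (f x - p.eval x)| ≤ max (-((C.mlo : ℚ) : ℝ)) ((C.xhi : ℚ) : ℝ) := by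
  obtain ⟨halt, hℓ, hxs⟩ := F.altSigns_of_altCheck hA hB
  set xs := pts.map fun e => ((e.1 : ℚ) : ℝ) with hxs_def
  have hlen' : n + 2 ≤ xs.length := by rw [hxs_def, List.length_map]; exact hlen
  have halt' : AltSigns (fun x => w x * (f x - p.eval x)) xs := by
    unfold AltSigns at halt ⊢
    refine List.IsChain.imp_of_mem_imp (fun u v hu hv huv => ⟨huv.1, ?_⟩) halt
    beta_reduce
    rw [← hD u (hxs u hu), ← hD v (hxs v hv)]
    exact huv.2
  have hδ : ∀ x ∈ xs, ((ℓ : ℚ) : ℝ) ≤ |w x * (f x - p.eval x)| := fun x hx => by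
    rw [← hD x (hxs x hx)]; exact hℓ x hx
  have hΔ : ∀ x ∈ Icc ((a : ℚ) : ℝ) ((b : ℚ) : ℝ), |w x * (f x - p.eval x)| ≤
      max (-((C.mlo : ℚ) : ℝ)) ((C.xhi : ℚ) : ℝ) := fun x hx => by
    rw [← hD x hx]; exact T.abs_le_of_extremaCheck hE hB x hx
  have hw' : ∀ x ∈ xs, 0 < w x := fun x hx => hw x (hxs x hx)
  obtain ⟨h1, h2⟩ := minimaxErr_mem_Icc halt' hδ hw' hp hlen' hxs hΔ
  refine ⟨h1, h2, fun q hq => ?_, hΔ⟩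
  obtain ⟨x, hx, hle⟩ := exists_le_abs_of_altSigns halt' hδ hw' hp hlen' q hq
  exact ⟨x, hxs x hx, hle⟩

/-- **Certified bracket of the weighted rational minimax error** over `R_{m,k}[a, b]`: for an error program `pD`
denoting `w·(f − P/Q)` on `[a, b]` (`deg P ≤ m`, `deg Q ≤ k`, `Q > 0`, `w > 0`), one alternation certificate
(`m + k + 2` points, modulus `ℓ`) and one extrema certificate give `ℓ ≤ E_{m,k}(f; w; [a, b]) ≤ max(−mlo, xhi)`, the
pointwise lower bound against every `P̃/Q̃ ∈ R_{m,k}[a, b]`, and the uniform upper bound for `P/Q`.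
[cite: Braess1986, Ch. III Thm 3.8] [cite: Braess1986, Ch. V Lemma 2.1 (2.2)] [cite: ChevillardEtAl2011, Algorithm 3.1] -/
theorem minimaxErrRat_bounds_of_checks {prm : M.Prm} {S : ℕ} {pD : GProg M} {B : PBox} {a b ℓ : ℚ} {sgn : Bool}
    {pts : List (ℚ × List (List ℤ × ℕ))} {C : ECert} (hA : M.altCheck prm S pD B a b ℓ sgn pts = true)
    (hE : T.extremaCheck prm S pD B a b C = true) {ps : List ℝ} (hB : BoxMem ps B) {f w : ℝ → ℝ} {P Q : ℝ[X]}
    {m k : ℕ} (hP : P.natDegree ≤ m) (hQ : Q.natDegree ≤ k) (hlen : m + k + 2 ≤ pts.length)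
    (hQpos : ∀ x ∈ Icc ((a : ℚ) : ℝ) ((b : ℚ) : ℝ), 0 < Q.eval x)
    (hw : ∀ x ∈ Icc ((a : ℚ) : ℝ) ((b : ℚ) : ℝ), 0 < w x)
    (hD : ∀ x ∈ Icc ((a : ℚ) : ℝ) ((b : ℚ) : ℝ), F.toFunP pD ps x = w x * (f x - P.eval x / Q.eval x)) :
    ((ℓ : ℚ) : ℝ) ≤ minimaxErrRat m k f w a b ∧
      minimaxErrRat m k f w a b ≤ max (-((C.mlo : ℚ) : ℝ)) ((C.xhi : ℚ) : ℝ) ∧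
      (∀ P' Q' : ℝ[X], P'.natDegree ≤ m → Q'.natDegree ≤ k → (∀ x ∈ Icc ((a : ℚ) : ℝ) ((b : ℚ) : ℝ), 0 < Q'.eval x) →
        ∃ x ∈ Icc ((a : ℚ) : ℝ) ((b : ℚ) : ℝ), ((ℓ : ℚ) : ℝ) ≤ |w x * (f x - P'.eval x / Q'.eval x)|) ∧
      ∀ x ∈ Icc ((a : ℚ) : ℝ) ((b : ℚ) : ℝ),
        |w x * (f x - P.eval x / Q.eval x)| ≤ max (-((C.mlo : ℚ) : ℝ)) ((C.xhi : ℚ) : ℝ) := by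
  obtain ⟨halt, hℓ, hxs⟩ := F.altSigns_of_altCheck hA hB
  set xs := pts.map fun e => ((e.1 : ℚ) : ℝ) with hxs_def
  have hlen' : m + k + 2 ≤ xs.length := by rw [hxs_def, List.length_map]; exact hlen
  have halt' : AltSigns (fun x => w x * (f x - P.eval x / Q.eval x)) xs := by
    unfold AltSigns at halt ⊢
    refine List.IsChain.imp_of_mem_imp (fun u v hu hv huv => ⟨huv.1, ?_⟩) halt
    beta_reduce
    rw [← hD u (hxs u hu), ← hD v (hxs v hv)]
    exact huv.2
  have hδ : ∀ x ∈ xs, ((ℓ : ℚ) : ℝ) ≤ |w x * (f x - P.eval x / Q.eval x)| := fun x hx => by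
    rw [← hD x (hxs x hx)]; exact hℓ x hx
  have hΔ : ∀ x ∈ Icc ((a : ℚ) : ℝ) ((b : ℚ) : ℝ), |w x * (f x - P.eval x / Q.eval x)| ≤
      max (-((C.mlo : ℚ) : ℝ)) ((C.xhi : ℚ) : ℝ) := fun x hx => by
    rw [← hD x hx]; exact T.abs_le_of_extremaCheck hE hB x hx
  have hw' : ∀ x ∈ xs, 0 < w x := fun x hx => hw x (hxs x hx)
  have hQxs : ∀ x ∈ xs, 0 < Q.eval x := fun x hx => hQpos x (hxs x hx)
  obtain ⟨h1, h2⟩ := minimaxErrRat_mem_Icc halt' hδ hw' hP hQ hQpos hlen' hxs hΔ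
  refine ⟨h1, h2, fun P' Q' hP' hQ' hQ'pos => ?_, hΔ⟩
  obtain ⟨x, hx, hle⟩ := exists_le_abs_of_altSigns_rat halt' hδ hw' hP hQ hQxs hlen' P' Q' hP' hQ'
    (fun x hx => hQ'pos x (hxs x hx))
  exact ⟨x, hxs x hx, hle⟩

end OpTangent

end PolyMP

end Literature.Analysis.ValidatedNumerics
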